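import Literature.Analysis.FluidPDE.TwoHalfNavierStokes
import Literature.Analysis.FunctionSpaces.TorusSpectralWeakDerivative
import Literature.Analysis.FluidPDE.PassiveScalarEnergySlice
import HarnessLib

/-!
# Spectral splitting of `2½`-dimensional fields: `‖∇(V,R)∘π‖² = ‖∇V‖² + ‖∇R‖²` for rough data

Analysis/FluidPDE support file (all proved). For integrable planar data `V : T² → ℝ²`,
`R : T² → ℝ`, the Fourier coefficients of the complexified `2½`-dimensional field
`(V, R) ∘ π` on `T³` (`Torus.twoHalf`, Majda–Bertozzi 2002, §2.3.1) live on the plane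
`k₂ = 0` of the frequency lattice `ℤ³`, where they are the coefficients of the planar pairing
`(V̂(k'), R̂(k'))` (`Torus.mFourierCoeff_comp_planarProj` of `TorusPlanarLift`). Consequently every
weighted `ℓ²` functional of the coefficients splits:

* `Torus.tsum_mul_enorm_sq_mFourierCoeff_twoHalf` — for every weight `w : ℤ³ → [0,∞]`,
  `∑_K w(K) ‖𝓕((V,R)∘π)(K)‖² = ∑_{k'} w(k',0) (‖V̂(k')‖² + |R̂(k')|²)`;
* `Torus.eGradNormSq_twoHalf` — the spectral dissipation splits,
  `eGradNormSq ((V,R)∘π) = eGradNormSq V + eScalarGradNormSq R` (the rough-data form of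
  `Torus.toReal_eGradNormSq_twoHalf`, Cheskidov 2023, §6 p. 19: `‖∇u^{ν_m}‖² = ‖∇v^m‖² + a_m²‖∇θ^m‖²`);
* `Torus.eSobolevNorm_sq_twoHalf` — the `H^s` norms split likewise, whence the comparisons
  `‖V‖_{H^s}, ‖R‖_{H^s} ≤ ‖(V,R)∘π‖_{H^s}` and the descent of `MemSobolev` / `MemL2Sobolev`
  (`Torus.memSobolev_of_twoHalf`, `Torus.memL2Sobolev_of_twoHalf`).

## References

* A. J. Majda, A. L. Bertozzi, *Vorticity and Incompressible Flow* (CUP 2002), §2.3.1.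
* A. Cheskidov, *Dissipation anomaly and anomalous dissipation in incompressible fluid flows*,
  arXiv:2311.04182 (2023), §6 p. 19.
* L. Grafakos, *Classical Fourier Analysis*, 3rd ed. (2014), Prop. 3.2.7 (3) (Parseval).
-/

open MeasureTheory Set Filter Topology Function UnitAddTorus
open scoped ENNReal NNReal InnerProductSpace
open Literature.Analysis.FunctionSpaces Literature.Analysis.FunctionSpaces.Torus

noncomputable section

namespace Literature.Analysis.FluidPDE

namespace Torus


/-! ## The planar frequencies inside `ℤ³` -/

section Freq

/-- Appending a zero third frequency is injective. [folklore] -/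
theorem snoc_zero_injective :
    Injective (fun k : Fin 2 → ℤ => (Fin.snoc (α := fun _ : Fin 3 => ℤ) k 0 : Fin 3 → ℤ)) := by
  intro k k' h
  funext j
  have h1 := congrFun h (Fin.castSucc j)
  simpa only [Fin.snoc_castSucc] using h1

/-- A frequency with vanishing third component is a planar frequency with a zero appended. [folklore] -/
theorem snoc_init_of_apply_last_eq_zero {K : Fin 3 → ℤ} (hK : K (Fin.last 2) = 0) :
    (Fin.snoc (α := fun _ : Fin 3 => ℤ) (fun j : Fin 2 => K (Fin.castSucc j)) 0 : Fin 3 → ℤ) = K := by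
  funext i
  refine Fin.lastCases ?_ (fun j => ?_) i
  · rw [Fin.snoc_last, hK]
  · rw [Fin.snoc_castSucc]

/-- `|(k', 0)|² = |k'|²`. [folklore] -/
theorem freqNormSq_snoc_zero (k : Fin 2 → ℤ) :
    freqNormSq (Fin.snoc (α := fun _ : Fin 3 => ℤ) k 0 : Fin 3 → ℤ) = freqNormSq k := by
  unfold freqNormSq
  rw [Fin.sum_univ_castSucc]
  simp only [Fin.snoc_castSucc, Fin.snoc_last, Int.cast_zero, ne_eq, OfNat.ofNat_ne_zero,
    not_false_eq_true, zero_pow, add_zero]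

/-- `⟨(k', 0)⟩^s = ⟨k'⟩^s`. [folklore] -/
theorem sobolevWeight_snoc_zero (s : ℝ) (k : Fin 2 → ℤ) :
    sobolevWeight s (Fin.snoc (α := fun _ : Fin 3 => ℤ) k 0 : Fin 3 → ℤ) = sobolevWeight s k := by
  unfold sobolevWeight
  rw [freqNormSq_snoc_zero]

end Freq

/-! ## Fourier coefficients of `2½`-dimensional fields -/

section Coeff

variable {V : (UnitAddTorus (Fin 2)) → (EuclideanSpace ℝ (Fin 2))} {R : (UnitAddTorus (Fin 2)) → ℝ}

/-- The complexified planar pairing `y ↦ (V y, R y) ∈ ℂ³` is measurable for measurable data. [folklore] -/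
theorem aestronglyMeasurable_complexify_pair (hV : AEStronglyMeasurable V volume) (hR : AEStronglyMeasurable R volume) :
    AEStronglyMeasurable (EuclideanSpace.complexify ∘ fun y : (UnitAddTorus (Fin 2)) => planarEmbed (V y, R y)) volume :=
  EuclideanSpace.continuous_complexify.comp_aestronglyMeasurable
    (planarEmbed.continuous.comp_aestronglyMeasurable (hV.prodMk hR))

/-- The complexified planar pairing is integrable for integrable data. [folklore] -/
theorem integrable_complexify_pair (hV : Integrable V volume) (hR : Integrable R volume) :
    Integrable (EuclideanSpace.complexify ∘ fun y : (UnitAddTorus (Fin 2)) => planarEmbed (V y, R y)) volume :=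
  ContinuousLinearMap.integrable_comp (EuclideanSpace.complexify (ι := Fin 3)).toContinuousLinearMap
    (planarEmbed.integrable_comp (hV.prodMk hR))

/-- Integrability of a real vector field is that of its complexification (`complexify` is an
isometric embedding). [folklore] -/
theorem integrable_complexify_comp_iff {X : Type*} [MeasurableSpace X] {μ : Measure X} {ι : Type*} [Fintype ι]
    {u : X → EuclideanSpace ℝ ι} :
    Integrable (EuclideanSpace.complexify ∘ u) μ ↔ Integrable u μ :=
  (EuclideanSpace.complexify (ι := ι)).lipschitz.integrable_comp_iff_of_antilipschitz
    (EuclideanSpace.complexify (ι := ι)).antilipschitz (map_zero _)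

/-- **Fourier coefficients of a `2½`-dimensional field**: for integrable `V`, `R`,
`𝓕(complexify ∘ (V,R)∘π)(K)` vanishes unless `K₂ = 0`, and then equals the coefficient at
`(K₀, K₁)` of the complexified planar pairing. [folklore] -/
theorem mFourierCoeff_complexify_twoHalf (hV : Integrable V volume) (hR : Integrable R volume) (K : Fin 3 → ℤ) :
    mFourierCoeff (EuclideanSpace.complexify ∘ twoHalf V R) K =
      if K (Fin.last 2) = 0 then
        mFourierCoeff (EuclideanSpace.complexify ∘ fun y : (UnitAddTorus (Fin 2)) => planarEmbed (V y, R y))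
          (fun j : Fin 2 => K (Fin.castSucc j))
      else 0 := by
  rw [twoHalf_eq_comp, ← Function.comp_assoc]
  exact mFourierCoeff_comp_planarProj (aestronglyMeasurable_complexify_pair hV.1 hR.1) K

/-- **The coefficients of the planar pairing split in norm**:
`‖𝓕(V,R)(k)‖² = ‖V̂(k)‖² + |R̂(k)|²` (componentwise coefficients). [folklore] -/
theorem enorm_sq_mFourierCoeff_pair (hV : Integrable V volume) (hR : Integrable R volume) (k : Fin 2 → ℤ) :
    ‖mFourierCoeff (EuclideanSpace.complexify ∘ fun y : (UnitAddTorus (Fin 2)) => planarEmbed (V y, R y)) k‖ₑ ^ 2 =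
      ‖mFourierCoeff (EuclideanSpace.complexify ∘ V) k‖ₑ ^ 2 + ‖mFourierCoeff (fun y => (R y : ℂ)) k‖ₑ ^ 2 := by
  have hP := integrable_complexify_pair hV hR
  have hVc : Integrable (EuclideanSpace.complexify ∘ V) volume := integrable_complexify_comp_iff.2 hV
  rw [enorm_sq_eq_sum_euclidean, enorm_sq_eq_sum_euclidean, Fin.sum_univ_castSucc]
  have h1 : ∀ j : Fin 2, (fun x => (EuclideanSpace.complexify ∘ fun y : (UnitAddTorus (Fin 2)) => planarEmbed (V y, R y)) x (Fin.castSucc j)) =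
      fun x => (EuclideanSpace.complexify ∘ V) x j := fun j => by
    funext y
    simp only [Function.comp_apply, EuclideanSpace.complexify_apply, planarEmbed_apply_castSucc]
  have h2 : (fun x => (EuclideanSpace.complexify ∘ fun y : (UnitAddTorus (Fin 2)) => planarEmbed (V y, R y)) x (Fin.last 2)) =
      fun y => (R y : ℂ) := by
    funext y
    simp only [Function.comp_apply, EuclideanSpace.complexify_apply, last_two_eq, planarEmbed_apply_two]
  congr 1
  · refine Finset.sum_congr rfl fun j _ => ?_
    rw [mFourierCoeff_apply_euclidean hP, mFourierCoeff_apply_euclidean hVc, h1 j]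
  · rw [mFourierCoeff_apply_euclidean hP, h2]

/-- **Weighted `ℓ²` functionals of the coefficients of a `2½`-dimensional field split**: for every
weight `w : ℤ³ → [0, ∞]`,
`∑_K w(K) ‖𝓕(complexify ∘ (V,R)∘π)(K)‖² = ∑_{k'} w(k',0) (‖V̂(k')‖² + |R̂(k')|²)`. [folklore] -/
theorem tsum_mul_enorm_sq_mFourierCoeff_twoHalf (hV : Integrable V volume) (hR : Integrable R volume)
    (w : (Fin 3 → ℤ) → ℝ≥0∞) :
    ∑' K : Fin 3 → ℤ, w K * ‖mFourierCoeff (EuclideanSpace.complexify ∘ twoHalf V R) K‖ₑ ^ 2 =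
      ∑' k : Fin 2 → ℤ, w (Fin.snoc (α := fun _ : Fin 3 => ℤ) k 0) *
        (‖mFourierCoeff (EuclideanSpace.complexify ∘ V) k‖ₑ ^ 2 + ‖mFourierCoeff (fun y => (R y : ℂ)) k‖ₑ ^ 2) := by
  set F : (Fin 3 → ℤ) → ℝ≥0∞ := fun K => w K * ‖mFourierCoeff (EuclideanSpace.complexify ∘ twoHalf V R) K‖ₑ ^ 2
    with hF
  have hsupp : support F ⊆ Set.range (fun k : Fin 2 → ℤ => (Fin.snoc (α := fun _ : Fin 3 => ℤ) k 0 : Fin 3 → ℤ)) := by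
    intro K hK
    by_cases hK0 : K (Fin.last 2) = 0
    · exact ⟨fun j => K (Fin.castSucc j), snoc_init_of_apply_last_eq_zero hK0⟩
    · exfalso
      apply hK
      simp only [hF, mFourierCoeff_complexify_twoHalf hV hR, if_neg hK0, enorm_zero, ne_eq,
        OfNat.ofNat_ne_zero, not_false_eq_true, zero_pow, mul_zero]
  rw [← snoc_zero_injective.tsum_eq hsupp]
  refine tsum_congr fun k => ?_
  simp only [hF]
  rw [mFourierCoeff_complexify_twoHalf hV hR,
    if_pos (show (Fin.snoc (α := fun _ : Fin 3 => ℤ) k 0 : Fin 3 → ℤ) (Fin.last 2) = 0 from Fin.snoc_last _ _)]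
  simp only [Fin.snoc_castSucc]
  rw [enorm_sq_mFourierCoeff_pair hV hR]

end Coeff

/-! ## Splitting of the spectral dissipation and of the Sobolev norms -/

section Split

variable {V : (UnitAddTorus (Fin 2)) → (EuclideanSpace ℝ (Fin 2))} {R : (UnitAddTorus (Fin 2)) → ℝ}

/-- **The spectral dissipation of a `2½`-dimensional field splits** (rough data):
`eGradNormSq ((V,R)∘π) = eGradNormSq V + eScalarGradNormSq R` for integrable `V`, `R`
(Cheskidov 2023, §6 p. 19, `‖∇u^{ν_m}‖² = ‖∇v^m‖² + a_m²‖∇θ^m‖²`, at the level of Fourier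
coefficients). [cite: Cheskidov2023, §6 p. 19] -/
theorem eGradNormSq_twoHalf (hV : Integrable V volume) (hR : Integrable R volume) :
    eGradNormSq (twoHalf V R) = eGradNormSq V + eScalarGradNormSq R := by
  rw [eGradNormSq_eq_tsum, eGradNormSq_eq_tsum, eScalarGradNormSq_eq_tsum, ← mul_add, ← ENNReal.tsum_add,
    tsum_mul_enorm_sq_mFourierCoeff_twoHalf hV hR]
  congr 1
  refine tsum_congr fun k => ?_
  rw [freqNormSq_snoc_zero, mul_add]

/-- **The `H^s` norms of a `2½`-dimensional field split**:
`‖complexify ∘ (V,R)∘π‖²_{H^s} = ‖complexify ∘ V‖²_{H^s} + ‖R‖²_{H^s}` for integrable `V`, `R`. [folklore] -/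
theorem eSobolevNorm_sq_twoHalf (hV : Integrable V volume) (hR : Integrable R volume) (s : ℝ) :
    eSobolevNorm s (EuclideanSpace.complexify ∘ twoHalf V R) ^ 2 =
      eSobolevNorm s (EuclideanSpace.complexify ∘ V) ^ 2 + eSobolevNorm s (fun y => (R y : ℂ)) ^ 2 := by
  simp only [eSobolevNorm, ENNReal.rpow_half_sq]
  rw [← ENNReal.tsum_add, tsum_mul_enorm_sq_mFourierCoeff_twoHalf hV hR]
  refine tsum_congr fun k => ?_
  rw [sobolevWeight_snoc_zero, mul_add]

/-- `‖complexify ∘ V‖_{H^s} ≤ ‖complexify ∘ (V,R)∘π‖_{H^s}`. [folklore] -/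
theorem eSobolevNorm_left_le_twoHalf (hV : Integrable V volume) (hR : Integrable R volume) (s : ℝ) :
    eSobolevNorm s (EuclideanSpace.complexify ∘ V) ≤ eSobolevNorm s (EuclideanSpace.complexify ∘ twoHalf V R) := by
  have h : eSobolevNorm s (EuclideanSpace.complexify ∘ V) ^ 2 ≤
      eSobolevNorm s (EuclideanSpace.complexify ∘ twoHalf V R) ^ 2 := by
    rw [eSobolevNorm_sq_twoHalf hV hR]
    exact le_self_add
  exact (ENNReal.pow_le_pow_left_iff two_ne_zero).1 h

/-- `‖R‖_{H^s} ≤ ‖complexify ∘ (V,R)∘π‖_{H^s}`. [folklore] -/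
theorem eSobolevNorm_right_le_twoHalf (hV : Integrable V volume) (hR : Integrable R volume) (s : ℝ) :
    eSobolevNorm s (fun y => (R y : ℂ)) ≤ eSobolevNorm s (EuclideanSpace.complexify ∘ twoHalf V R) := by
  have h : eSobolevNorm s (fun y => (R y : ℂ)) ^ 2 ≤
      eSobolevNorm s (EuclideanSpace.complexify ∘ twoHalf V R) ^ 2 := by
    rw [eSobolevNorm_sq_twoHalf hV hR]
    exact le_add_self
  exact (ENNReal.pow_le_pow_left_iff two_ne_zero).1 h

/-- `eGradNormSq V ≤ eGradNormSq ((V,R)∘π)`. [folklore] -/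
theorem eGradNormSq_left_le_twoHalf (hV : Integrable V volume) (hR : Integrable R volume) :
    eGradNormSq V ≤ eGradNormSq (twoHalf V R) := by
  rw [eGradNormSq_twoHalf hV hR]
  exact le_self_add

/-- `eScalarGradNormSq R ≤ eGradNormSq ((V,R)∘π)`. [folklore] -/
theorem eScalarGradNormSq_right_le_twoHalf (hV : Integrable V volume) (hR : Integrable R volume) :
    eScalarGradNormSq R ≤ eGradNormSq (twoHalf V R) := by
  rw [eGradNormSq_twoHalf hV hR]
  exact le_add_self

/-- **`H^s` membership descends to the sections** of an integrable `2½`-dimensional field. [folklore] -/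
theorem memSobolev_of_twoHalf (hV : Integrable V volume) (hR : Integrable R volume) {s : ℝ}
    (h : MemSobolev s (EuclideanSpace.complexify ∘ twoHalf V R)) :
    MemSobolev s (EuclideanSpace.complexify ∘ V) ∧ MemSobolev s (fun y => (R y : ℂ)) :=
  ⟨⟨integrable_complexify_comp_iff.2 hV, (eSobolevNorm_left_le_twoHalf hV hR s).trans_lt h.2⟩,
    ⟨Complex.ofRealCLM.integrable_comp hR, (eSobolevNorm_right_le_twoHalf hV hR s).trans_lt h.2⟩⟩

variable {a b : ℝ} {v : ℝ → (UnitAddTorus (Fin 2)) → (EuclideanSpace ℝ (Fin 2))} {θ : ℝ → (UnitAddTorus (Fin 2)) → ℝ}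

/-- **`L²_t H^s_x` membership descends to the sections** of a time-dependent `2½`-dimensional
field with a.e. integrable slices (the clause `Torus.MemL2Sobolev` of `Torus.IsLerayHopfOn`). [folklore] -/
theorem memL2Sobolev_of_twoHalf {s : ℝ}
    (hint : ∀ᵐ t ∂(volume.restrict (Ioo a b)), Integrable (v t) volume ∧ Integrable (θ t) volume)
    (h : MemL2Sobolev a b s (fun t => EuclideanSpace.complexify ∘ twoHalf (v t) (θ t))) :
    MemL2Sobolev a b s (fun t => EuclideanSpace.complexify ∘ v t) ∧
      MemL2Sobolev a b s (fun t y => (θ t y : ℂ)) := by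
  obtain ⟨hmem, hfin⟩ := h
  have hfin' : ∫⁻ t in Ioo a b, eSobolevNorm s (EuclideanSpace.complexify ∘ twoHalf (v t) (θ t)) ^ 2 < ⊤ := by
    unfold eL2SobolevNorm at hfin
    by_contra hc
    rw [not_lt, top_le_iff] at hc
    rw [hc, ENNReal.top_rpow_of_pos (by norm_num)] at hfin
    exact lt_irrefl _ hfin
  have hL : ∫⁻ t in Ioo a b, eSobolevNorm s (EuclideanSpace.complexify ∘ v t) ^ 2 ≤
      ∫⁻ t in Ioo a b, eSobolevNorm s (EuclideanSpace.complexify ∘ twoHalf (v t) (θ t)) ^ 2 := by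
    refine lintegral_mono_ae ?_
    filter_upwards [hint] with t ht
    gcongr
    exact eSobolevNorm_left_le_twoHalf ht.1 ht.2 s
  have hRt : ∫⁻ t in Ioo a b, eSobolevNorm s (fun y => (θ t y : ℂ)) ^ 2 ≤
      ∫⁻ t in Ioo a b, eSobolevNorm s (EuclideanSpace.complexify ∘ twoHalf (v t) (θ t)) ^ 2 := by
    refine lintegral_mono_ae ?_
    filter_upwards [hint] with t ht
    gcongr
    exact eSobolevNorm_right_le_twoHalf ht.1 ht.2 s
  refine ⟨⟨?_, ?_⟩, ⟨?_, ?_⟩⟩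
  · filter_upwards [hmem, hint] with t ht hi
    exact (memSobolev_of_twoHalf hi.1 hi.2 ht).1
  · unfold eL2SobolevNorm
    exact ENNReal.rpow_lt_top_of_nonneg (by norm_num) (hL.trans_lt hfin').ne
  · filter_upwards [hmem, hint] with t ht hi
    exact (memSobolev_of_twoHalf hi.1 hi.2 ht).2
  · unfold eL2SobolevNorm
    exact ENNReal.rpow_lt_top_of_nonneg (by norm_num) (hRt.trans_lt hfin').ne

/-- Real form of the splitting at a slice where both sections have finite dissipation:
`(eGradNormSq ((V,R)∘π)).toReal = (eGradNormSq V).toReal + (eScalarGradNormSq R).toReal`. [folklore] -/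
theorem toReal_eGradNormSq_twoHalf_of_ne_top (hV : Integrable V volume) (hR : Integrable R volume)
    (hV' : eGradNormSq V ≠ ⊤) (hR' : eScalarGradNormSq R ≠ ⊤) :
    (eGradNormSq (twoHalf V R)).toReal = (eGradNormSq V).toReal + (eScalarGradNormSq R).toReal := by
  rw [eGradNormSq_twoHalf hV hR, ENNReal.toReal_add hV' hR']

/-- Real form of the splitting as an inequality, valid at every slice (if one of the sections has
infinite dissipation, so has the field, and the left side is the junk value `0`):
`(eGradNormSq ((V,R)∘π)).toReal ≤ (eGradNormSq V).toReal + (eScalarGradNormSq R).toReal`. [folklore] -/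
theorem toReal_eGradNormSq_twoHalf_le (hV : Integrable V volume) (hR : Integrable R volume) :
    (eGradNormSq (twoHalf V R)).toReal ≤ (eGradNormSq V).toReal + (eScalarGradNormSq R).toReal := by
  rw [eGradNormSq_twoHalf hV hR]
  exact ENNReal.toReal_add_le

end Split

end Torus

end Literature.Analysis.FluidPDE

end
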